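import Summits.MatrixMultiplication.OmegaCensus.STPP222IcosetWSearch

/-!
# ω-census, icoset class negatives at 2-rank four: kernel evaluation chunks for `𝔽₂⁴ × ℤ₅`, `K = 6` (part L)

HONEST FRAMING (pub-omega census; verbatim): lottery ticket; floor = certified bounds/negative ranges.
Census STRUCTURE bookkeeping (Q7, the involution-coset class at 2-rank four; OMEGA-TABLE NR216), nothing about `ω`.  Pure kernel
evaluations of the witness-model search of `STPP222IcosetWSearch.lean` — `IcosetW.chunk 5 6 [1,2,3,4] c₁ lo hi` (all sorted code
tuples `0 ≤ c₁ ≤ … ≤ c₅ < 25` of the `H`-data `(β_t, γ_t) ∈ ℤ₅²`, `t = 1 … 5`, code `5β + γ`, `β₀ = γ₀ = 0`, with the given `c₁` and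
`lo ≤ c₂ < hi`; every CANONICAL one — lexicographically minimal under re-basing at any triple and scaling by a unit — has its zero
list refuted by the search `vrefute` from the standard frame) and `IcosetW.chunk3 … c₁ c₂ lo hi` (the same with `c₂` fixed and
`lo ≤ c₃ < hi`).  Soundness, reduction and assembly: `STPP222IcosetWSearchSound*.lean`, `STPP222IcosetRankFourReduction.lean`,
`STPP222IcosetClassNoneK6R4Z5.lean`.  Sizes (tuples / canonical classes / search nodes) from the seat's bit-exact Python twin of the
engine (whole cell: 38 025 tuples with `c₁ ≤ 1`, 6 055 canonical classes, 62 432 nodes, 0 unrefuted; ≈ 18 ms/node on the farm).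
Seat pub-omega-kernel-l4 (gen 20), 2026-08-27.
-/

namespace Summit.MatrixMultiplication.OmegaCensus

namespace IcosetW

/-- Kernel evaluation: classes with `c₁ = 2` (all `c₂`): every such sorted tuple is NON-canonical (pigeonhole on `β` among six triples in `ℤ₅`), so only the canonical test runs. -/
theorem chunk_z5_six_2_2_25 : chunk 5 6 [1, 2, 3, 4] 2 2 25 = true := by decide +kernel

/-- Kernel evaluation: classes with `c₁ = 3` (all `c₂`): every such sorted tuple is NON-canonical (pigeonhole on `β` among six triples in `ℤ₅`), so only the canonical test runs. -/
theorem chunk_z5_six_3_3_25 : chunk 5 6 [1, 2, 3, 4] 3 3 25 = true := by decide +kernel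

/-- Kernel evaluation: classes with `c₁ = 4` (all `c₂`): every such sorted tuple is NON-canonical (pigeonhole on `β` among six triples in `ℤ₅`), so only the canonical test runs. -/
theorem chunk_z5_six_4_4_25 : chunk 5 6 [1, 2, 3, 4] 4 4 25 = true := by decide +kernel

/-- Kernel evaluation: classes with `c₁ = 5` (all `c₂`): every such sorted tuple is NON-canonical (pigeonhole on `β` among six triples in `ℤ₅`), so only the canonical test runs. -/
theorem chunk_z5_six_5_5_25 : chunk 5 6 [1, 2, 3, 4] 5 5 25 = true := by decide +kernel

end IcosetW

end Summit.MatrixMultiplication.OmegaCensus
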